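import Literature.Probability.Percolation.BondTriangularDualLaw
import Literature.Probability.LatticeModels.LatticeInterfaceProofs
import HarnessLib

/-!
# Faces of `𝕋` versus vertices of the brick wall: the dictionary of planar duality

Topic `Literature/Probability/Percolation`; theorems only. The brick wall `bwGraph`
(`BondTriangularDual`) is the planar dual of the triangular lattice `𝕋 = triGraph` drawn on the
bricks: its vertices are the corners `corner f` of the faces `f : HexVertex` of `𝕋`
(`TriangularLattice.lean`: `hexFaceVertices`, `triEdgeFaces d` = (left face, right face) of a dart
`d`), and the brick-wall edge `brickWallEdge j` crossing the edge `j` of `𝕋` joins the corners of the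
two faces bordering `j` — "each dual bond `e*` crosses exactly one bond `e`" (Bollobás–Riordan,
*Percolation* (2006), Ch. 5, proof of Thm. 11, p. 136; Grimmett, *Percolation* (1999), §11.2 and
Fig. 11.30). This file makes the dictionary explicit:

* `triEdgeFaces_add_e0`, …, `triEdgeFaces_add_neg_triDiag` — the two faces of each of the six
  darts `x → x ± e₀`, `x ± e₁`, `x ± (e₀ - e₁)`;
* `corner_triEdgeFaces` — `{corner (left face), corner (right face)} = brickWallEdge (d.edge)`,
  hence the two corners are adjacent in the brick wall (`bwGraph_adj_corner_triEdgeFaces`);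
* `exists_dart_of_mem_triDual` — an open dual edge is `{corner f₁, corner f₂}` for the two faces of
  a *closed* edge of `𝕋`;
* `exists_face_of_exit` — the step of an open dual path out of the inside corners of a vertex set
  `S` (`insideCorners`): the face reached has two vertices in `S` joined by a closed edge and a
  vertex outside `S` (the input of the dual exit events `dExit`).

## References

* B. Bollobás, O. Riordan, *Percolation*, CUP (2006), Ch. 5, proof of Thm. 11 (p. 136–137) and of
  Thm. 16 (p. 148). [BollobasRiordan2006]
* G. Grimmett, *Percolation*, 2nd ed. (1999), §11.2, §11.9 Fig. 11.30. [GrimmettPercolation1999]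
-/

namespace Literature.Probability.Percolation

namespace BondTri

open LatticeModels StarTriangle

noncomputable section

/-! ### The two faces of each dart -/

/-- Reduction of `triEdgeFaces` of the dart `x → x + v` to the origin (`triFace` is translation
covariant, `triFace_add`). [folklore] -/
theorem triEdgeFaces_of_eq_add {x v : Site 2} (h : triGraph.Adj x (x + v)) :
    triEdgeFaces ⟨(x, x + v), h⟩ =
      ((x + (triFace 0 v (triRot60 v)).1, (triFace 0 v (triRot60 v)).2),
        (x + (triFace 0 v (triRotNeg60 v)).1, (triFace 0 v (triRotNeg60 v)).2)) := by
  show (triFace x (x + v) (x + triRot60 (x + v - x)),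
    triFace x (x + v) (x + triRotNeg60 (x + v - x))) = _
  rw [add_sub_cancel_left]
  have e1 : triFace x (x + v) (x + triRot60 v) =
      (x + (triFace 0 v (triRot60 v)).1, (triFace 0 v (triRot60 v)).2) := by
    rw [← triFace_add, add_zero]
  have e2 : triFace x (x + v) (x + triRotNeg60 v) =
      (x + (triFace 0 v (triRotNeg60 v)).1, (triFace 0 v (triRotNeg60 v)).2) := by
    rw [← triFace_add, add_zero]
  rw [e1, e2]

/-- The faces of `x → x + e₀`: left the up triangle of `x`, right the down triangle of `x - e₁`. [folklore] -/
theorem triEdgeFaces_add_e0 (x : Site 2) (h : triGraph.Adj x (x + Pi.single 0 1)) :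
    triEdgeFaces ⟨(x, x + Pi.single 0 1), h⟩ = ((x, 0), (x + -Pi.single 1 1, 1)) := by
  have h1 : triFace 0 (Pi.single 0 1) (triRot60 (Pi.single 0 1)) = ((0 : Site 2), 0) := by decide
  have h2 : triFace 0 (Pi.single 0 1) (triRotNeg60 (Pi.single 0 1)) = (-(Pi.single 1 1 : Site 2), 1) := by
    decide
  rw [triEdgeFaces_of_eq_add, h1, h2, add_zero]

/-- The faces of `x → x - e₀`. [folklore] -/
theorem triEdgeFaces_add_neg_e0 (x : Site 2) (h : triGraph.Adj x (x + -Pi.single 0 1)) :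
    triEdgeFaces ⟨(x, x + -Pi.single 0 1), h⟩ =
      ((x + (-Pi.single 0 1 - Pi.single 1 1), 1), (x + -Pi.single 0 1, 0)) := by
  have h1 : triFace 0 (-Pi.single 0 1) (triRot60 (-Pi.single 0 1)) =
      (-(Pi.single 0 1 : Site 2) - Pi.single 1 1, 1) := by decide
  have h2 : triFace 0 (-Pi.single 0 1) (triRotNeg60 (-Pi.single 0 1)) = (-(Pi.single 0 1 : Site 2), 0) := by
    decide
  rw [triEdgeFaces_of_eq_add, h1, h2]

/-- The faces of `x → x + e₁`. [folklore] -/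
theorem triEdgeFaces_add_e1 (x : Site 2) (h : triGraph.Adj x (x + Pi.single 1 1)) :
    triEdgeFaces ⟨(x, x + Pi.single 1 1), h⟩ = ((x + -Pi.single 0 1, 1), (x, 0)) := by
  have h1 : triFace 0 (Pi.single 1 1) (triRot60 (Pi.single 1 1)) = (-(Pi.single 0 1 : Site 2), 1) := by
    decide
  have h2 : triFace 0 (Pi.single 1 1) (triRotNeg60 (Pi.single 1 1)) = ((0 : Site 2), 0) := by decide
  rw [triEdgeFaces_of_eq_add, h1, h2, add_zero]

/-- The faces of `x → x - e₁`. [folklore] -/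
theorem triEdgeFaces_add_neg_e1 (x : Site 2) (h : triGraph.Adj x (x + -Pi.single 1 1)) :
    triEdgeFaces ⟨(x, x + -Pi.single 1 1), h⟩ =
      ((x + -Pi.single 1 1, 0), (x + (-Pi.single 0 1 - Pi.single 1 1), 1)) := by
  have h1 : triFace 0 (-Pi.single 1 1) (triRot60 (-Pi.single 1 1)) = (-(Pi.single 1 1 : Site 2), 0) := by
    decide
  have h2 : triFace 0 (-Pi.single 1 1) (triRotNeg60 (-Pi.single 1 1)) =
      (-(Pi.single 0 1 : Site 2) - Pi.single 1 1, 1) := by decide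
  rw [triEdgeFaces_of_eq_add, h1, h2]

/-- The faces of `x → x + (e₀ - e₁)`. [folklore] -/
theorem triEdgeFaces_add_triDiag (x : Site 2) (h : triGraph.Adj x (x + triDiag)) :
    triEdgeFaces ⟨(x, x + triDiag), h⟩ = ((x + -Pi.single 1 1, 1), (x + -Pi.single 1 1, 0)) := by
  have h1 : triFace 0 triDiag (triRot60 triDiag) = (-(Pi.single 1 1 : Site 2), 1) := by decide
  have h2 : triFace 0 triDiag (triRotNeg60 triDiag) = (-(Pi.single 1 1 : Site 2), 0) := by decide
  rw [triEdgeFaces_of_eq_add, h1, h2]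

/-- The faces of `x → x - (e₀ - e₁)`. [folklore] -/
theorem triEdgeFaces_add_neg_triDiag (x : Site 2) (h : triGraph.Adj x (x + -triDiag)) :
    triEdgeFaces ⟨(x, x + -triDiag), h⟩ = ((x + -Pi.single 0 1, 0), (x + -Pi.single 0 1, 1)) := by
  have h1 : triFace 0 (-triDiag) (triRot60 (-triDiag)) = (-(Pi.single 0 1 : Site 2), 0) := by decide
  have h2 : triFace 0 (-triDiag) (triRotNeg60 (-triDiag)) = (-(Pi.single 0 1 : Site 2), 1) := by decide
  rw [triEdgeFaces_of_eq_add, h1, h2]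

/-! ### Corners of the two faces of an edge are the endpoints of its dual edge -/

/-- `brickWallEdge` of an edge written backwards from its far endpoint. [folklore] -/
theorem brickWallEdge_neg (x v : Site 2) :
    brickWallEdge s(x, x + -v) = brickWallEdge s(x + -v, x + -v + v) := by
  rw [neg_add_cancel_right, Sym2.eq_swap]

-- one coordinate simp set serves all twelve coordinate identities below
set_option linter.unusedSimpArgs false in
/-- **The dual edge of an edge of `𝕋` joins the corners of its two faces**:
`{corner (left face of d), corner (right face of d)} = brickWallEdge d.edge` for every dart `d` —
"each dual bond crosses exactly one bond" made explicit for the brick-wall drawing.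
[cite: BollobasRiordan2006, Ch. 5, proof of Thm. 11 (p. 136) and Fig. 15] -/
theorem corner_triEdgeFaces (d : triGraph.Dart) :
    s(corner (triEdgeFaces d).1, corner (triEdgeFaces d).2) = brickWallEdge d.edge := by
  obtain ⟨⟨x, y⟩, h⟩ := d
  have h' := h
  rcases (triGraph_adj_iff_eq_add x y).1 h' with rfl | rfl | rfl | rfl | rfl | rfl
  · rw [triEdgeFaces_add_e0]
    show _ = brickWallEdge s(x, x + Pi.single 0 1)
    rw [brickWallEdge_horizontal, Sym2.eq_swap]
    congr 1 <;> refine Site.eq_iff_two.2 ⟨?_, ?_⟩ <;>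
      (rw [← sub_eq_zero]; simp only [corner_apply_zero, corner_apply_one, Pi.add_apply, Pi.neg_apply, Pi.sub_apply, single_zero_apply_zero, single_zero_apply_one, single_one_apply_zero, single_one_apply_one, triDiag_zero, triDiag_one, Matrix.cons_val_zero, Matrix.cons_val_one, Matrix.head_cons, Fin.isValue, Fin.val_zero, Fin.val_one, Nat.cast_zero, Nat.cast_one, neg_zero]; omega)
  · rw [triEdgeFaces_add_neg_e0]
    show _ = brickWallEdge s(x, x + -Pi.single 0 1)
    rw [brickWallEdge_neg, brickWallEdge_horizontal]
    congr 1 <;> refine Site.eq_iff_two.2 ⟨?_, ?_⟩ <;>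
      (rw [← sub_eq_zero]; simp only [corner_apply_zero, corner_apply_one, Pi.add_apply, Pi.neg_apply, Pi.sub_apply, single_zero_apply_zero, single_zero_apply_one, single_one_apply_zero, single_one_apply_one, triDiag_zero, triDiag_one, Matrix.cons_val_zero, Matrix.cons_val_one, Matrix.head_cons, Fin.isValue, Fin.val_zero, Fin.val_one, Nat.cast_zero, Nat.cast_one, neg_zero]; omega)
  · rw [triEdgeFaces_add_e1]
    show _ = brickWallEdge s(x, x + Pi.single 1 1)
    rw [brickWallEdge_vertical]
    congr 1 <;> refine Site.eq_iff_two.2 ⟨?_, ?_⟩ <;>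
      (rw [← sub_eq_zero]; simp only [corner_apply_zero, corner_apply_one, Pi.add_apply, Pi.neg_apply, Pi.sub_apply, single_zero_apply_zero, single_zero_apply_one, single_one_apply_zero, single_one_apply_one, triDiag_zero, triDiag_one, Matrix.cons_val_zero, Matrix.cons_val_one, Matrix.head_cons, Fin.isValue, Fin.val_zero, Fin.val_one, Nat.cast_zero, Nat.cast_one, neg_zero]; omega)
  · rw [triEdgeFaces_add_neg_e1]
    show _ = brickWallEdge s(x, x + -Pi.single 1 1)
    rw [brickWallEdge_neg, brickWallEdge_vertical, Sym2.eq_swap]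
    congr 1 <;> refine Site.eq_iff_two.2 ⟨?_, ?_⟩ <;>
      (rw [← sub_eq_zero]; simp only [corner_apply_zero, corner_apply_one, Pi.add_apply, Pi.neg_apply, Pi.sub_apply, single_zero_apply_zero, single_zero_apply_one, single_one_apply_zero, single_one_apply_one, triDiag_zero, triDiag_one, Matrix.cons_val_zero, Matrix.cons_val_one, Matrix.head_cons, Fin.isValue, Fin.val_zero, Fin.val_one, Nat.cast_zero, Nat.cast_one, neg_zero]; omega)
  · rw [triEdgeFaces_add_triDiag]
    show _ = brickWallEdge s(x, x + triDiag)
    -- `x + triDiag = (x + triDiag) ` is the cell `t = x - e₁ ... `: `{x, x + e₀ - e₁}` backwards is the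
    -- diagonal edge of the cell `x + triDiag`: `{t, t - e₀ + e₁}` with `t = x + triDiag`
    have : s(x, x + triDiag) = s(x + triDiag, x + triDiag - Pi.single 0 1 + Pi.single 1 1) := by
      rw [Sym2.eq_swap]
      congr 1
      refine Site.eq_iff_two.2 ⟨?_, ?_⟩ <;> simp
    rw [this, brickWallEdge_diagonal, Sym2.eq_swap]
    congr 1 <;> refine Site.eq_iff_two.2 ⟨?_, ?_⟩ <;>
      (rw [← sub_eq_zero]; simp only [corner_apply_zero, corner_apply_one, Pi.add_apply, Pi.neg_apply, Pi.sub_apply, single_zero_apply_zero, single_zero_apply_one, single_one_apply_zero, single_one_apply_one, triDiag_zero, triDiag_one, Matrix.cons_val_zero, Matrix.cons_val_one, Matrix.head_cons, Fin.isValue, Fin.val_zero, Fin.val_one, Nat.cast_zero, Nat.cast_one, neg_zero]; omega)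
  · rw [triEdgeFaces_add_neg_triDiag]
    show _ = brickWallEdge s(x, x + -triDiag)
    have : s(x, x + -triDiag) = s(x, x - Pi.single 0 1 + Pi.single 1 1) := by
      congr 1
      refine Site.eq_iff_two.2 ⟨?_, ?_⟩ <;>
      (rw [← sub_eq_zero]; simp only [corner_apply_zero, corner_apply_one, Pi.add_apply, Pi.neg_apply, Pi.sub_apply, single_zero_apply_zero, single_zero_apply_one, single_one_apply_zero, single_one_apply_one, triDiag_zero, triDiag_one, Matrix.cons_val_zero, Matrix.cons_val_one, Matrix.head_cons, Fin.isValue, Fin.val_zero, Fin.val_one, Nat.cast_zero, Nat.cast_one, neg_zero]; omega)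
    rw [this, brickWallEdge_diagonal]
    congr 1 <;> refine Site.eq_iff_two.2 ⟨?_, ?_⟩ <;>
      (rw [← sub_eq_zero]; simp only [corner_apply_zero, corner_apply_one, Pi.add_apply, Pi.neg_apply, Pi.sub_apply, single_zero_apply_zero, single_zero_apply_one, single_one_apply_zero, single_one_apply_one, triDiag_zero, triDiag_one, Matrix.cons_val_zero, Matrix.cons_val_one, Matrix.head_cons, Fin.isValue, Fin.val_zero, Fin.val_one, Nat.cast_zero, Nat.cast_one, neg_zero]; omega)

/-- The corners of the two faces of an edge of `𝕋` are adjacent in the brick wall. [folklore] -/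
theorem bwGraph_adj_corner_triEdgeFaces (d : triGraph.Dart) :
    bwGraph.Adj (corner (triEdgeFaces d).1) (corner (triEdgeFaces d).2) := by
  have h := brickWallEdge_mem_bwGraph d.edge_mem
  rwa [← corner_triEdgeFaces] at h

/-- The corners of the two faces of an edge of `𝕋` are adjacent in `ℤ²`. [folklore] -/
theorem zdGraph_adj_corner_triEdgeFaces (d : triGraph.Dart) :
    (zdGraph 2).Adj (corner (triEdgeFaces d).1) (corner (triEdgeFaces d).2) :=
  bwGraph_le_zdGraph (bwGraph_adj_corner_triEdgeFaces d)

/-- The corners of the two faces of an edge are distinct. [folklore] -/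
theorem corner_triEdgeFaces_ne (d : triGraph.Dart) :
    corner (triEdgeFaces d).1 ≠ corner (triEdgeFaces d).2 :=
  (bwGraph_adj_corner_triEdgeFaces d).ne

/-! ### Open dual edges -/

/-- **An open dual edge crosses a closed edge of `𝕋`**: every edge of `triDual ω` is
`{corner f₁, corner f₂}` for the two faces `f₁, f₂` of a dart of `𝕋` whose edge is closed in `ω`.
[cite: BollobasRiordan2006, Ch. 5, proof of Thm. 11 (p. 136)] -/
theorem exists_dart_of_mem_triDual {ω : Set (Sym2 (Site 2))} {u v : Site 2}
    (h : s(u, v) ∈ triDual ω) :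
    ∃ d : triGraph.Dart, d.edge ∉ ω ∧
      s(u, v) = s(corner (triEdgeFaces d).1, corner (triEdgeFaces d).2) := by
  obtain ⟨hbw, hclosed⟩ := mem_triDual_iff.1 h
  obtain ⟨j, hj, hje⟩ := exists_brickWallEdge_eq hbw
  induction j using Sym2.ind with
  | h a b =>
    refine ⟨⟨(a, b), (SimpleGraph.mem_edgeSet _).1 hj⟩, ?_, ?_⟩
    · show s(a, b) ∉ ω
      rw [← hje, invFunOn_brickWallEdge hj] at hclosed
      exact hclosed
    · rw [corner_triEdgeFaces]
      exact hje.symm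

/-- Conversely, the dual edge of a closed edge of `𝕋` is open. [folklore] -/
theorem corner_mem_triDual_iff {ω : Set (Sym2 (Site 2))} (d : triGraph.Dart) :
    s(corner (triEdgeFaces d).1, corner (triEdgeFaces d).2) ∈ triDual ω ↔ d.edge ∉ ω := by
  rw [corner_triEdgeFaces, brickWallEdge_mem_triDual_iff d.edge_mem]

/-! ### The step of a dual path out of the inside corners -/

/-- **Leaving the inside corners.** If an open dual edge joins an inside corner `k'` of the finite
vertex set `S` (`insideCorners S`: corners of faces with all vertices in `S`) to a corner `a` that is
not inside, then `a` is the corner of a face with two distinct vertices in `S` joined by a closed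
edge of `𝕋` and a vertex outside `S`. [cite: BollobasRiordan2006, Ch. 5, proof of Thm. 11 (p. 137)] -/
theorem exists_face_of_exit {S : Finset (Site 2)} {ω : Set (Sym2 (Site 2))} {k' a : Site 2}
    (hk : k' ∈ insideCorners S) (ha : a ∉ insideCorners S) (he : s(k', a) ∈ triDual ω) :
    ∃ f : HexVertex, corner f = a ∧ ∃ x ∈ hexFaceVertices f, ∃ y ∈ hexFaceVertices f,
      x ≠ y ∧ x ∈ S ∧ y ∈ S ∧ s(x, y) ∉ ω ∧ ∃ c ∈ hexFaceVertices f, c ∉ S := by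
  obtain ⟨d, hd, hda⟩ := exists_dart_of_mem_triDual he
  have hmem := mem_hexFaceVertices_triEdgeFaces d
  have key : ∀ f g : HexVertex, k' = corner f → a = corner g →
      d.fst ∈ hexFaceVertices f → d.snd ∈ hexFaceVertices f →
      d.fst ∈ hexFaceVertices g → d.snd ∈ hexFaceVertices g →
      ∃ f : HexVertex, corner f = a ∧ ∃ x ∈ hexFaceVertices f, ∃ y ∈ hexFaceVertices f,
        x ≠ y ∧ x ∈ S ∧ y ∈ S ∧ s(x, y) ∉ ω ∧ ∃ c ∈ hexFaceVertices f, c ∉ S := by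
    intro f g hf hg h1 h2 h3 h4
    have hfS : hexFaceVertices f ⊆ S := subset_of_corner_mem_insideCorners (hf ▸ hk)
    have hgS : ¬ hexFaceVertices g ⊆ S := fun h => ha (hg ▸ corner_mem_insideCorners h)
    obtain ⟨c, hc, hcS⟩ := Finset.not_subset.1 hgS
    exact ⟨g, hg.symm, d.fst, h3, d.snd, h4, d.adj.ne, hfS h1, hfS h2, hd, c, hc, hcS⟩
  rcases Sym2.eq_iff.1 hda with ⟨h1, h2⟩ | ⟨h1, h2⟩
  · exact key _ _ h1 h2 hmem.1.1 hmem.1.2 hmem.2.1 hmem.2.2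
  · exact key _ _ h1 h2 hmem.2.1 hmem.2.2 hmem.1.1 hmem.1.2

/-- Two distinct vertices of a face are adjacent in `𝕋`, and the face is one of the two faces of
the dart joining them (`exists_eq_triEdgeFaces_of_mem_hexFaceVertices`, restated). [folklore] -/
theorem adj_of_mem_hexFaceVertices {f : HexVertex} {x y : Site 2} (hx : x ∈ hexFaceVertices f)
    (hy : y ∈ hexFaceVertices f) (hxy : x ≠ y) : triGraph.Adj x y := by
  obtain ⟨h, -⟩ := exists_eq_triEdgeFaces_of_mem_hexFaceVertices hx hy hxy
  exact h

end

end BondTri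

end Literature.Probability.Percolation
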